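import Literature.Topology.FourManifolds.ClosedModelRelOrientation
import Literature.AlgebraicTopology.SingularHomology.CohomologyMayerVietorisExtend
import Literature.AlgebraicTopology.SingularHomology.CohomologyHomotopyInvariance
import Literature.AlgebraicTopology.SingularHomology.CohomologyOfPoint
import HarnessLib

/-!
# `Hᵏ(Ŵ) ≅ Hᵏ(Ŵ ∖ ∞)` in the middle range, for the closed model of a manifold bounded by a homology sphere

M. Kervaire, J. Milnor, *Groups of homotopy spheres I*, Ann. of Math. 77 (1963), §7, footnote
pp. 528–529 and §2 p. 508: the signature of a compact `W` bounded by a homotopy sphere `Σ` is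
that of the closed homology manifold `Ŵ = W ∪ cone(Σ)`; since `H^j(Σ) = 0` for `0 < j < n`, the
middle-dimensional cohomology of `Ŵ` is that of `W` (equivalently of `Ŵ ∖ ∞ ≅ W ∖ ∂W`). This is
the Mayer–Vietoris argument for the open cover `Ŵ = (Ŵ ∖ ∞) ∪ N₁` by the punctured model and the
cone neighbourhood `N₁ = {∞} ∪ κ(∂W × (0, 1))` of a collar `κ` (contractible,
`contractibleSpace_coneNhd`), whose intersection `N₁ ∖ ∞` deformation retracts along the collar
onto `∂W ≅ M` (Hatcher 2002, §3.1 pp. 203–204; §2.1 Prop. 2.22 for the collar).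

* `NullCobordism.collarHomotopyEquiv` — `κ(∂W × [0,1)) ≃ₕ M`;
* `NullCobordism.puncturedConeHomotopyEquiv` — `N₁ ∖ ∞ ≃ₕ M`;
* `NullCobordism.isZero_singularCohomology_coneNhd` — `H^j(N₁) = 0` for `j ≠ 0`;
* `NullCobordism.bijective_map_subsetIncl_compl_infty` — for `2 ≤ k ≤ m + 1` and
  `H^j(M; ℤ) = 0` (`1 ≤ j ≤ m + 1`), restriction `Hᵏ(Ŵ; ℤ) → Hᵏ(Ŵ ∖ ∞; ℤ)` is bijective.

Everything is proved; no named facts.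

## References

* M. A. Kervaire, J. W. Milnor, *Groups of homotopy spheres: I*, Ann. of Math. (2) 77 (1963),
  §2 p. 508, §7 footnote pp. 528–529. [KervaireMilnorAnnals1963]
* A. Hatcher, *Algebraic Topology*, CUP 2002, §3.1 pp. 203–204. [HatcherAT2002]
-/

noncomputable section

open scoped Manifold ContDiff Topology unitInterval
open Set Function CategoryTheory CategoryTheory.Limits Topology TopologicalSpace
open Literature.AlgebraicTopology.SingularHomology

namespace Literature.Topology.FourManifolds

namespace NullCobordism

variable {m : ℕ} {M : Type} [TopologicalSpace M] [ChartedSpace (EuclideanSpace ℝ (Fin (m + 1))) M]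
  [IsManifold (𝓡 (m + 1)) ∞ M] (c : NullCobordism.{0} (m + 1) M) (κ : c.boundaryData.Collar)
  [Nonempty M] [CompactSpace M]

/-! ### The collar and the punctured cone deformation retract onto `M` -/

omit [CompactSpace M] in
/-- `collarInv (κ p) = p`. [folklore] -/
theorem collarInv_collar (p : M × Set.Icc (0 : ℝ) 1) : c.collarInv κ (κ p) = p :=
  κ.injective (c.collar_collarInv κ (mem_range_self p))

/-- **The open collar `κ(∂W × [0, 1))` is homotopy equivalent to `M`**: project to the `M`
coordinate, include `M` as the bottom `κ(M × 0) = ∂W`, and slide down the collar lines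
(`collarSlide`; Hatcher 2002, proof of Prop. 2.22). [cite: HatcherAT2002, §2.1 Prop. 2.22] -/
def collarHomotopyEquiv : ContinuousMap.HomotopyEquiv ↥(c.collarNhd κ 1) M where
  toFun := ⟨fun y => (c.collarInv κ y.1).1,
    continuous_fst.comp ((c.continuousOn_collarInv κ).comp_continuous continuous_subtype_val
      fun y => c.collarNhd_subset_range κ 1 y.2)⟩
  invFun := ⟨fun x => ⟨κ (x, ⊥), (c.collar_mem_collarNhd_iff κ (x, ⊥)).2
      (by rw [Set.Icc.coe_bot]; exact one_pos)⟩,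
    (κ.continuous.comp (Continuous.prodMk continuous_id continuous_const)).subtype_mk _⟩
  left_inv := by
    refine ContinuousMap.Homotopic.symm ⟨
      { toContinuousMap := c.collarSlide κ 1
        map_zero_left := fun y => c.collarSlide_zero κ 1 y
        map_one_left := fun y => ?_ }⟩
    apply Subtype.ext
    change (c.collarSlide κ 1 (1, y) : c.W) = κ ((c.collarInv κ y.1).1, ⊥)
    rw [collarSlide_apply_coe, slide_one]
  right_inv := by
    have h : ∀ x : M, (c.collarInv κ (κ (x, ⊥))).1 = x := fun x => by rw [collarInv_collar]
    exact ⟨{ toContinuousMap := ⟨fun p => p.2, continuous_snd⟩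
             map_zero_left := fun x => (h x).symm
             map_one_left := fun x => rfl }⟩

/-- **The punctured cone neighbourhood `N₁ ∖ ∞` is homotopy equivalent to `M`**: it is the
interior part of the collar, which includes into the open collar by a homotopy equivalence
(`collarInteriorHomotopyEquiv`), itself homotopy equivalent to `M`. [cite: HatcherAT2002, §2.1 Prop. 2.22] -/
def puncturedConeHomotopyEquiv :
    ContinuousMap.HomotopyEquiv
      ↥(Subtype.val ⁻¹' c.coneNhd κ 1 : Set ↥({ClosedModel.infty}ᶜ : Set (ClosedModel (m + 1) c.W))) M :=
  ((c.interiorHomeoCollar κ).symm.toHomotopyEquiv.trans (c.collarInteriorHomotopyEquiv κ)).trans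
    (c.collarHomotopyEquiv κ)

/-- The intersection `{∞}ᶜ ∩ N₁ ⊆ Ŵ` as a subspace is the punctured cone `N₁ ↓∩ (Ŵ ∖ ∞)`.
[folklore] -/
def interPuncturedConeHomeo :
    ↥(({ClosedModel.infty}ᶜ : Set (ClosedModel (m + 1) c.W)) ∩ c.coneNhd κ 1) ≃ₜ
      ↥(Subtype.val ⁻¹' c.coneNhd κ 1 : Set ↥({ClosedModel.infty}ᶜ : Set (ClosedModel (m + 1) c.W))) where
  toFun z := ⟨⟨z.1, z.2.1⟩, z.2.2⟩
  invFun w := ⟨w.1.1, w.1.2, w.2⟩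
  left_inv _ := rfl
  right_inv _ := rfl
  continuous_toFun := (continuous_subtype_val.subtype_mk _).subtype_mk _
  continuous_invFun := (continuous_subtype_val.comp continuous_subtype_val).subtype_mk _

omit [CompactSpace M] in
/-- **`H^j({∞}ᶜ ∩ N₁; ℤ) = 0` whenever `H^j(M; ℤ) = 0`.** [cite: HatcherAT2002, §3.1 p. 201] -/
theorem isZero_singularCohomology_inter_coneNhd {j : ℕ} (hM : IsZero (singularCohomology ℤ ℤ M j)) :
    IsZero (singularCohomology ℤ ℤ
      ↥(({ClosedModel.infty}ᶜ : Set (ClosedModel (m + 1) c.W)) ∩ c.coneNhd κ 1) j) :=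
  IsZero.of_iso hM ((singularCohomology.mapIso ℤ ℤ (c.interPuncturedConeHomeo κ) j).symm ≪≫
    (singularCohomology.isoOfHomotopyEquiv' ℤ ℤ (c.puncturedConeHomotopyEquiv κ) j).symm)

/-- **`H^j(N₁; ℤ) = 0` for `j ≠ 0`**: the cone neighbourhood is contractible
(`contractibleSpace_coneNhd`). [cite: HatcherAT2002, §3.1 p. 201] -/
theorem isZero_singularCohomology_coneNhd {j : ℕ} (hj : j ≠ 0) :
    IsZero (singularCohomology ℤ ℤ ↥(c.coneNhd κ 1) j) := by
  haveI := c.contractibleSpace_coneNhd κ (le_refl (1 : ℝ))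
  exact IsZero.of_iso (singularCochainComplex.isZero_singularCohomology_of_subsingleton' (R := ℤ) (M := ℤ) hj)
    (singularCohomology.isoOfContractible ℤ ℤ ↥(c.coneNhd κ 1) j).symm

/-! ### Restriction to the punctured model -/

/-- **`Hᵏ(Ŵ; ℤ) → Hᵏ(Ŵ ∖ ∞; ℤ)` is bijective for `2 ≤ k ≤ m + 1` when `H^j(M; ℤ) = 0` for
`1 ≤ j ≤ m + 1`** (Kervaire–Milnor 1963, §7 footnote and §2 p. 508: for `∂W` a homology sphere
the middle cohomology of `Ŵ` is that of `W`). Mayer–Vietoris for the open cover of `Ŵ` by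
`Ŵ ∖ ∞` and the contractible cone neighbourhood `N₁`, whose intersection is homotopy equivalent
to `M` (Hatcher 2002, §3.1 pp. 203–204). [cite: KervaireMilnorAnnals1963, §7 footnote pp. 528–529] -/
theorem bijective_map_subsetIncl_compl_infty (κ : c.boundaryData.Collar) {k : ℕ} (hk : 2 ≤ k)
    (hM : ∀ j, 1 ≤ j → j ≤ k → IsZero (singularCohomology ℤ ℤ M j)) :
    Bijective (singularCohomology.map ℤ ℤ
      (subsetIncl ({ClosedModel.infty}ᶜ : Set (ClosedModel (m + 1) c.W))) k) := by
  obtain ⟨p, rfl⟩ : ∃ p, k = p + 1 := ⟨k - 1, by omega⟩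
  have hA : IsOpen ({ClosedModel.infty}ᶜ : Set (ClosedModel (m + 1) c.W)) := isOpen_compl_singleton
  have hB : IsOpen (c.coneNhd κ 1) := c.isOpen_coneNhd κ one_pos le_rfl
  have hAB : ({ClosedModel.infty}ᶜ : Set (ClosedModel (m + 1) c.W)) ∪ c.coneNhd κ 1 = univ := by
    refine eq_univ_of_forall fun x => ?_
    by_cases hx : x = ClosedModel.infty
    · exact Or.inr (hx ▸ c.infty_mem_coneNhd κ 1)
    · exact Or.inl hx
  constructor
  · rw [injective_iff_map_eq_zero]
    intro a ha
    refine singularCohomology.eq_zero_of_map_subsetIncl_eq_zero ℤ hA hB hAB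
      (c.isZero_singularCohomology_inter_coneNhd κ (hM p (by omega) (by omega))) a ha ?_
    exact ModuleCat.eq_zero_of_isZero_obj (c.isZero_singularCohomology_coneNhd κ (by omega)) _
  · intro a
    obtain ⟨x, hx, -⟩ := singularCohomology.exists_map_subsetIncl_eq_of_isZero ℤ hA hB hAB
      (c.isZero_singularCohomology_inter_coneNhd κ (hM (p + 1) (by omega) le_rfl)) a
    exact ⟨x, hx⟩

end NullCobordism

end Literature.Topology.FourManifolds
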